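import Mathlib.Analysis.SpecialFunctions.Pow.Integral
import Mathlib.Analysis.SpecialFunctions.ImproperIntegrals
import Mathlib.Analysis.SpecialFunctions.Integrability.Basic
import Literature.Analysis.FunctionSpaces.WeakLp
import HarnessLib

/-!
# Weak `L^p` is locally `L^q` for `q < p`

Analysis/FunctionSpaces proofs file (no new definitions) over `WeakLp.lean`
(`Literature.Analysis.FunctionSpaces.MemWeakLp`, Grafakos Def. 1.1.5). The classical embedding
`L^{p,∞}(μ) ⊂ L^q(S, μ)` for every `0 < q < p` and every set `S` of finite measure (Grafakos,
*Classical Fourier Analysis*, Exercise 1.1.11 / the computation of Prop. 1.1.6–1.1.14: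
`∫_S |f|^q = q ∫₀^∞ t^{q−1} μ_S{|f| > t} dt ≤ q ∫₀¹ t^{q−1} μ(S) dt + q ∫₁^∞ t^{q−1−p} ‖f‖^p_{L^{p,∞}} dt
< ∞`), by the layer-cake formula (`MeasureTheory.lintegral_rpow_eq_lintegral_meas_lt_mul`). In
particular `L³_w(ℝ³) ⊂ L²_loc(ℝ³)` — the standing remark of the forward self-similar theory
(Bradshaw–Tsai, Ann. Henri Poincaré 18 (2017), §1: "`L³_w(ℝ³)` embeds continuously into the space
of uniformly locally square integrable functions `L²_{u loc}`"), used with `bradshawTsai2019_prop_3_1`.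

* `MemWeakLp.setLIntegral_enorm_rpow_lt_top` — `∫_S ‖f‖^q < ∞` for `f ∈ L^{p,∞}`, `0 < q < p`,
  `μ S < ∞`.
* `MemWeakLp.setLIntegral_enorm_sq_lt_top_of_two_lt` — the case `q = 2 < p` with the square as a
  natural power, and `MemWeakLp.locallyIntegrable_norm_sq` — `‖f‖² ∈ L¹_loc` for `f ∈ L^{p,∞}`,
  `2 < p`, on a locally finite measure.

## References

* L. Grafakos, *Classical Fourier Analysis*, 3rd ed., GTM 249 (2014), §1.1 (Prop. 1.1.6,
  Exercise 1.1.11).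
* Z. Bradshaw, T.-P. Tsai, Ann. Henri Poincaré 18 (2017) 1095–1119, §1 [BradshawTsai2017AHP].
-/

noncomputable section

open MeasureTheory Set Filter Topology
open scoped ENNReal NNReal

namespace Literature.Analysis.FunctionSpaces

variable {α : Type*} [MeasurableSpace α] {E : Type*} [NormedAddCommGroup E]
variable {f : α → E} {p : ℝ≥0∞} {μ : Measure α}

omit [MeasurableSpace α] in
/-- The superlevel sets of `‖f‖` at a positive real level, in the `ℝ≥0∞` form of `eWeakLpPow`. [folklore] -/
theorem setOf_coe_toNNReal_lt_enorm_eq {t : ℝ} (ht : 0 < t) :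
    {x | ((t.toNNReal : ℝ≥0) : ℝ≥0∞) < ‖f x‖ₑ} = {x | t < ‖f x‖} := by
  ext x
  simp only [mem_setOf_eq]
  rw [← ofReal_norm, ← ENNReal.ofReal.eq_1, ENNReal.ofReal_lt_ofReal_iff_of_nonneg ht.le]

/-- **Chebyshev form of weak-`L^p` membership at real levels**: `t^p μ{‖f‖ > t} ≤ ‖f‖^p_{L^{p,∞}}`
for `0 < t`. [folklore] -/
theorem ofReal_rpow_mul_meas_lt_le_eWeakLpPow (f : α → E) (p : ℝ≥0∞) (μ : Measure α) {t : ℝ}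
    (ht : 0 < t) :
    ENNReal.ofReal (t ^ p.toReal) * μ {x | t < ‖f x‖} ≤ eWeakLpPow f p μ := by
  have h := rpow_mul_meas_lt_le_eWeakLpPow f p μ t.toNNReal
  rwa [setOf_coe_toNNReal_lt_enorm_eq ht, ← ENNReal.ofReal.eq_1, ENNReal.ofReal_rpow_of_pos ht]
    at h

/-- The distribution function of a weak-`L^p` function is at most `‖f‖^p_{L^{p,∞}} / t^p`. [folklore] -/
theorem meas_lt_norm_le_eWeakLpPow_mul_inv (f : α → E) (p : ℝ≥0∞) (μ : Measure α) {t : ℝ}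
    (ht : 0 < t) :
    μ {x | t < ‖f x‖} ≤ eWeakLpPow f p μ * (ENNReal.ofReal (t ^ p.toReal))⁻¹ := by
  have h := ofReal_rpow_mul_meas_lt_le_eWeakLpPow f p μ ht
  have h0 : ENNReal.ofReal (t ^ p.toReal) ≠ 0 :=
    (ENNReal.ofReal_pos.2 (Real.rpow_pos_of_pos ht _)).ne'
  rw [← div_eq_mul_inv, ENNReal.le_div_iff_mul_le (Or.inl h0) (Or.inl ENNReal.ofReal_ne_top),
    mul_comm]
  exact h

/-- **Weak `L^p` is locally `L^q` for `q < p`** (Grafakos, §1.1): if `f ∈ L^{p,∞}(μ)`,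
`0 < q < p` and `μ S < ∞`, then `∫_S ‖f‖^q dμ < ∞`. Proof: layer cake on `μ|_S`,
`μ|_S{‖f‖ > t} ≤ min(μ S, ‖f‖^p_{p,∞} t^{-p})`, and `∫₀¹ t^{q−1} dt`, `∫₁^∞ t^{q−1−p} dt` are
finite. [folklore] -/
theorem MemWeakLp.setLIntegral_enorm_rpow_lt_top (hf : MemWeakLp f p μ) {q : ℝ} (hq : 0 < q)
    (hqp : q < p.toReal) {S : Set α} (hS : μ S ≠ ∞) :
    ∫⁻ x in S, ‖f x‖ₑ ^ q ∂μ < ∞ := by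
  have hp : 0 < p.toReal := hq.trans hqp
  set W : ℝ≥0∞ := eWeakLpPow f p μ with hW
  have hWtop : W ≠ ∞ := hf.2.ne
  have hmeas : AEMeasurable (fun x => ‖f x‖) (μ.restrict S) :=
    hf.1.norm.aemeasurable.restrict
  have hnn : 0 ≤ᵐ[μ.restrict S] fun x => ‖f x‖ := Eventually.of_forall fun x => norm_nonneg _
  have hlhs : ∫⁻ x in S, ‖f x‖ₑ ^ q ∂μ = ∫⁻ x in S, ENNReal.ofReal (‖f x‖ ^ q) ∂μ :=
    lintegral_congr fun x => by
      rw [← ofReal_norm, ENNReal.ofReal_rpow_of_nonneg (norm_nonneg _) hq.le]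
  rw [hlhs, lintegral_rpow_eq_lintegral_meas_lt_mul (μ.restrict S) hnn hmeas hq]
  refine ENNReal.mul_lt_top ENNReal.ofReal_lt_top ?_
  -- pointwise bound of the integrand by the sum of the two tails
  set g₁ : ℝ → ℝ≥0∞ := fun t => μ S * ENNReal.ofReal (t ^ (q - 1)) with hg₁
  set g₂ : ℝ → ℝ≥0∞ := fun t => W * ENNReal.ofReal (t ^ (q - 1 - p.toReal)) with hg₂
  have hbound : ∀ t ∈ Ioi (0 : ℝ),
      (μ.restrict S) {a | t < ‖f a‖} * ENNReal.ofReal (t ^ (q - 1)) ≤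
        (Ioc 0 1).indicator g₁ t + (Ioi 1).indicator g₂ t := by
    intro t ht
    have ht0 : 0 < t := ht
    rcases le_or_gt t 1 with h1 | h1
    · rw [indicator_of_mem (mem_Ioc.2 ⟨ht0, h1⟩) g₁]
      refine le_add_right ?_
      refine mul_le_mul_left ?_ _
      calc (μ.restrict S) {a | t < ‖f a‖} ≤ (μ.restrict S) univ := measure_mono (subset_univ _)
        _ = μ S := Measure.restrict_apply_univ _
    · rw [indicator_of_mem (mem_Ioi.2 h1) g₂]
      refine le_add_left ?_
      have h2 : (μ.restrict S) {a | t < ‖f a‖} ≤ W * (ENNReal.ofReal (t ^ p.toReal))⁻¹ :=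
        (Measure.le_iff'.1 Measure.restrict_le_self _).trans
          (meas_lt_norm_le_eWeakLpPow_mul_inv f p μ ht0)
      calc (μ.restrict S) {a | t < ‖f a‖} * ENNReal.ofReal (t ^ (q - 1))
          ≤ W * (ENNReal.ofReal (t ^ p.toReal))⁻¹ * ENNReal.ofReal (t ^ (q - 1)) :=
            mul_le_mul_left h2 _
        _ = g₂ t := by
            rw [hg₂, mul_assoc, ← ENNReal.ofReal_inv_of_pos (Real.rpow_pos_of_pos ht0 _),
              ← Real.rpow_neg ht0.le, ← ENNReal.ofReal_mul (Real.rpow_nonneg ht0.le _),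
              ← Real.rpow_add ht0]
            congr 3
            ring
  -- the two tails are finite
  have hI₁ : ∫⁻ t in Ioc (0 : ℝ) 1, ENNReal.ofReal (t ^ (q - 1)) < ∞ := by
    have hint : IntegrableOn (fun t : ℝ => t ^ (q - 1)) (Ioc 0 1) volume :=
      (intervalIntegral.intervalIntegrable_rpow' (a := 0) (b := 1) (by linarith)).1
    refine lt_of_le_of_lt (lintegral_mono fun t => Real.ofReal_le_enorm _) ?_
    exact hint.2
  have hI₂ : ∫⁻ t in Ioi (1 : ℝ), ENNReal.ofReal (t ^ (q - 1 - p.toReal)) < ∞ := by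
    have hint : IntegrableOn (fun t : ℝ => t ^ (q - 1 - p.toReal)) (Ioi 1) volume :=
      integrableOn_Ioi_rpow_of_lt (by linarith) zero_lt_one
    refine lt_of_le_of_lt (lintegral_mono fun t => Real.ofReal_le_enorm _) ?_
    exact hint.2
  have hg₁m : Measurable ((Ioc (0 : ℝ) 1).indicator g₁) :=
    (measurable_const.mul (by fun_prop)).indicator measurableSet_Ioc
  calc ∫⁻ t in Ioi 0, (μ.restrict S) {a | t < ‖f a‖} * ENNReal.ofReal (t ^ (q - 1))
      ≤ ∫⁻ t in Ioi 0, (Ioc 0 1).indicator g₁ t + (Ioi 1).indicator g₂ t :=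
        setLIntegral_mono' measurableSet_Ioi hbound
    _ = (∫⁻ t in Ioc (0 : ℝ) 1, g₁ t) + ∫⁻ t in Ioi (1 : ℝ), g₂ t := by
        rw [lintegral_add_left hg₁m, lintegral_indicator measurableSet_Ioc,
          lintegral_indicator measurableSet_Ioi, Measure.restrict_restrict measurableSet_Ioc,
          Measure.restrict_restrict measurableSet_Ioi,
          inter_eq_left.2 (Ioc_subset_Ioi_self : Ioc (0 : ℝ) 1 ⊆ Ioi 0),
          inter_eq_left.2 (Ioi_subset_Ioi zero_le_one : Ioi (1 : ℝ) ⊆ Ioi 0)]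
    _ = μ S * (∫⁻ t in Ioc (0 : ℝ) 1, ENNReal.ofReal (t ^ (q - 1))) +
          W * ∫⁻ t in Ioi (1 : ℝ), ENNReal.ofReal (t ^ (q - 1 - p.toReal)) := by
        simp only [hg₁, hg₂]
        rw [lintegral_const_mul' _ _ hS, lintegral_const_mul' _ _ hWtop]
    _ < ∞ := ENNReal.add_lt_top.2 ⟨ENNReal.mul_lt_top hS.lt_top hI₁, ENNReal.mul_lt_top hf.2 hI₂⟩

/-- **`L^{p,∞} ⊂ L²(S)` for `2 < p` and `μ S < ∞`**, with the square as a natural power (the form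
`∫_S ‖f‖ₑ²` of the fluid files): e.g. `L³_w(ℝ³) ⊂ L²_loc(ℝ³)` (Bradshaw–Tsai 2017, §1). [cite: BradshawTsai2017AHP, §1 (L^3_w ⊂ L^2_uloc)] -/
theorem MemWeakLp.setLIntegral_enorm_sq_lt_top_of_two_lt (hf : MemWeakLp f p μ)
    (hp : 2 < p.toReal) {S : Set α} (hS : μ S ≠ ∞) :
    ∫⁻ x in S, ‖f x‖ₑ ^ 2 ∂μ < ∞ := by
  have h := hf.setLIntegral_enorm_rpow_lt_top zero_lt_two hp hS
  refine lt_of_eq_of_lt (lintegral_congr fun x => ?_) h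
  rw [← ENNReal.rpow_two]

/-- **`‖f‖² ∈ L¹_loc` for `f ∈ L^{p,∞}`, `2 < p`**, on a locally finite measure over a topological
space: `L^{p,∞} ⊂ L²_loc` (Grafakos §1.1; Bradshaw–Tsai 2017, §1 for `L³_w(ℝ³) ⊂ L²_{uloc}`). [cite: BradshawTsai2017AHP, §1 (L^3_w ⊂ L^2_uloc)] -/
theorem MemWeakLp.locallyIntegrable_norm_sq [TopologicalSpace α] [IsLocallyFiniteMeasure μ]
    (hf : MemWeakLp f p μ) (hp : 2 < p.toReal) :
    LocallyIntegrable (fun x => ‖f x‖ ^ 2) μ := by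
  intro x
  obtain ⟨U, hU, hUfin⟩ := μ.finiteAt_nhds x
  refine ⟨U, hU, ?_, ?_⟩
  · exact ((continuous_pow 2).comp_aestronglyMeasurable hf.1.norm).restrict
  · rw [hasFiniteIntegral_iff_enorm]
    refine lt_of_eq_of_lt (lintegral_congr fun y => ?_)
      (hf.setLIntegral_enorm_sq_lt_top_of_two_lt hp hUfin.ne)
    rw [Real.enorm_eq_ofReal (sq_nonneg _), ENNReal.ofReal_pow (norm_nonneg _), ofReal_norm]

end Literature.Analysis.FunctionSpaces

end
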